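import Mathlib.Analysis.SpecialFunctions.Log.Basic
import Mathlib.Analysis.SpecialFunctions.Pow.Real
import Mathlib.Analysis.SpecialFunctions.Complex.Log
import Summits.Schanuel.Schanuel.Theorems.ZilberEacComplexGraphEscapeLemmas
import HarnessLib

/-!
# Lemmas for EC by escape with polynomial top coefficients (moving logarithms)

Auxiliary facts for `ZilberEacComplexGraphEscapeTop.lean` (Exponential-Algebraic Closedness over graph
bases of any degree, fibres `yⱼ = Tⱼ(x') yₙ^{κⱼ} + …` with NON-constant top coefficients; first open
rung `dim π₁(V) = n - 1`, Mantova–Masser, PLMS 129 (2024), §1 p. 5):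
`tendsto_one_add_log_pow_div` (`(1 + c₁ log r + c₂)ᴺ / r → 0`), `eval_eq_of_totalDegree_eq_zero`,
`norm_top_sub_le` (the top coefficient along the escaping ray:
`‖T(τκ + w) - t τᵈ‖ ≤ C (1 + ‖w‖)ᴺ 2ᵈ rᵈ / r` for `r ≥ 2`, `r/2 ≤ ‖τ‖ ≤ 2r`, any `d`),
`exists_nat_escape_radius` (an integer `k ≥ 1` with `(2πk/a)^{1/D}` beyond any threshold),
`latticeConst_norm` / `latticeConst_exp` (`K₀ = 2πiσk`: `‖K₀‖ = 2πk`, `e^{K₀} = 1`).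
HONEST FRAMING: auxiliary estimates for a modest sub-rung of EAC; nothing bears on Schanuel's conjecture.
-/

noncomputable section

open Complex MvPolynomial Metric Set Filter Topology

set_option linter.dupNamespace false

namespace Summit.Schanuel.Schanuel.Theorems

/-- `(1 + c₁ log r + c₂)ᴺ / r → 0` as `r → ∞` (`c₁, c₂ ≥ 0`): for `r ≥ e`,
`1 + c₁ log r + c₂ ≤ (1 + c₁ + c₂) log r`, and `logᴺ r / r → 0`. [folklore] -/
theorem tendsto_one_add_log_pow_div {c₁ c₂ : ℝ} (hc₁ : 0 ≤ c₁) (hc₂ : 0 ≤ c₂) (N : ℕ) :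
    Tendsto (fun r : ℝ => (1 + c₁ * Real.log r + c₂) ^ N / r) atTop (𝓝 0) := by
  have h1 := Real.tendsto_pow_log_div_mul_add_atTop 1 0 N one_ne_zero
  have h2 : Tendsto (fun r : ℝ => (1 + c₁ + c₂) ^ N * (Real.log r ^ N / (1 * r + 0))) atTop
      (𝓝 0) := by
    have := h1.const_mul ((1 + c₁ + c₂) ^ N); rwa [mul_zero] at this
  refine squeeze_zero_norm' ?_ h2
  filter_upwards [eventually_ge_atTop (Real.exp 1)] with r hr
  have hr0 : 0 < r := (Real.exp_pos 1).trans_le hr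
  have hlog : 1 ≤ Real.log r := by
    rw [← Real.log_exp 1]; exact Real.log_le_log (Real.exp_pos 1) hr
  have hle : 1 + c₁ * Real.log r + c₂ ≤ (1 + c₁ + c₂) * Real.log r := by nlinarith
  rw [Real.norm_of_nonneg (by positivity), one_mul, add_zero, ← mul_div_assoc]
  refine div_le_div_of_nonneg_right ?_ hr0.le
  rw [← mul_pow]
  exact pow_le_pow_left₀ (by positivity) hle N

/-- A polynomial of total degree `0` is constant: `p(x) = p₀(κ)` where `p₀` is its degree-`0`
homogeneous component. [folklore] -/
theorem eval_eq_of_totalDegree_eq_zero {s : ℕ} {p : MvPolynomial (Fin s) ℂ} (hp : p.totalDegree = 0)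
    (x κ : Fin s → ℂ) : eval x p = eval κ (homogeneousComponent p.totalDegree p) := by
  rw [hp, homogeneousComponent_zero, eval_C]
  conv_lhs => rw [totalDegree_eq_zero_iff_eq_C.mp hp, eval_C]

/-- **The top coefficient along the escaping ray.** Let `T ∈ ℂ[x₁..xₛ]` have total degree `d` and
leading form `T_d`, `t = T_d(κ)`. With the constants `C, N` of the ray expansion
(`exists_norm_eval_ray_sub_le`), for `r ≥ 2` and `r/2 ≤ ‖τ‖ ≤ 2r`:
`‖T(τκ + w) - t τᵈ‖ ≤ C (1 + ‖w‖)ᴺ 2ᵈ rᵈ / r` (for `d = 0` the left side vanishes). [folklore] -/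
theorem norm_top_sub_le {s : ℕ} (T : MvPolynomial (Fin s) ℂ) (κ : Fin s → ℂ) {C : ℝ} (hC : 0 ≤ C)
    {N : ℕ} (hray : ∀ τ : ℂ, 1 ≤ ‖τ‖ → ∀ w : Fin s → ℂ,
      ‖eval (τ • κ + w) T - τ ^ T.totalDegree * eval κ (homogeneousComponent T.totalDegree T)‖ ≤
        C * (1 + ‖w‖) ^ N * ‖τ‖ ^ (T.totalDegree - 1))
    {r : ℝ} (hr : 2 ≤ r) {τ : ℂ} (hτlo : r / 2 ≤ ‖τ‖) (hτhi : ‖τ‖ ≤ 2 * r) (w : Fin s → ℂ) :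
    ‖eval (τ • κ + w) T - eval κ (homogeneousComponent T.totalDegree T) * τ ^ T.totalDegree‖ ≤
      C * (1 + ‖w‖) ^ N * 2 ^ T.totalDegree * r ^ T.totalDegree / r := by
  have hr0 : 0 < r := by linarith
  rcases Nat.eq_zero_or_pos T.totalDegree with hd | hd
  · rw [mul_comm, ← eval_eq_of_totalDegree_eq_zero hd (τ • κ + w) κ, hd, pow_zero, one_mul,
      sub_self, norm_zero]
    positivity
  · have hτ1 : 1 ≤ ‖τ‖ := by linarith
    rw [mul_comm (eval κ _)]
    refine (hray τ hτ1 w).trans ?_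
    obtain ⟨d', hd'⟩ : ∃ d', T.totalDegree = d' + 1 := ⟨T.totalDegree - 1, by omega⟩
    rw [hd', Nat.add_sub_cancel]
    have e1 : ‖τ‖ ^ d' ≤ (2 * r) ^ d' := pow_le_pow_left₀ (norm_nonneg _) hτhi _
    have e2 : (2 * r) ^ d' = 2 ^ (d' + 1) * r ^ (d' + 1) / r / 2 := by
      rw [mul_pow, pow_succ, pow_succ]; field_simp
    calc C * (1 + ‖w‖) ^ N * ‖τ‖ ^ d' ≤ C * (1 + ‖w‖) ^ N * (2 * r) ^ d' :=
          mul_le_mul_of_nonneg_left e1 (by positivity)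
      _ = C * (1 + ‖w‖) ^ N * 2 ^ (d' + 1) * r ^ (d' + 1) / r / 2 := by rw [e2]; ring
      _ ≤ C * (1 + ‖w‖) ^ N * 2 ^ (d' + 1) * r ^ (d' + 1) / r := by
          apply div_le_self (by positivity) (by norm_num)

/-- **An escape radius beyond any threshold.** For `a > 0`, `D ≠ 0` and any `R` there is an integer
`k ≥ 1` with `R ≤ (2πk/a)^{1/D}`. [folklore] -/
theorem exists_nat_escape_radius {a : ℝ} (ha : 0 < a) {D : ℕ} (hD : D ≠ 0) (R : ℝ) :
    ∃ k : ℕ, 0 < k ∧ R ≤ (2 * Real.pi * k / a) ^ ((D : ℝ)⁻¹) := by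
  obtain ⟨k, hk0, hkR⟩ : ∃ k : ℕ, 0 < k ∧ max R 0 ^ D ≤ 2 * Real.pi * k / a := by
    refine ⟨⌈a * max R 0 ^ D / (2 * Real.pi)⌉₊ + 1, Nat.succ_pos _, ?_⟩
    rw [le_div_iff₀ ha]
    have h1 := Nat.le_ceil (a * max R 0 ^ D / (2 * Real.pi))
    have h2 : a * max R 0 ^ D / (2 * Real.pi) * (2 * Real.pi) = a * max R 0 ^ D := by
      field_simp
    have h3 := mul_le_mul_of_nonneg_right h1 (by positivity : (0 : ℝ) ≤ 2 * Real.pi)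
    rw [h2] at h3
    push_cast
    nlinarith [Real.pi_pos, h3]
  refine ⟨k, hk0, ?_⟩
  have h1 : max R 0 ≤ (2 * Real.pi * k / a) ^ ((D : ℝ)⁻¹) := by
    have := Real.rpow_le_rpow (by positivity) hkR (inv_nonneg.mpr (Nat.cast_nonneg D))
    rwa [Real.pow_rpow_inv_natCast (le_max_right _ _) hD] at this
  exact (le_max_left _ _).trans h1

/-- The lattice constant `K₀ = 2πiσk` (`σ = ±1`) has norm `2πk`. [folklore] -/
theorem latticeConst_norm {σ : ℝ} (hσ : σ = 1 ∨ σ = -1) (k : ℕ) :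
    ‖(((2 * Real.pi * k * σ : ℝ) : ℂ) * I)‖ = 2 * Real.pi * k := by
  have hσabs : |σ| = 1 := by rcases hσ with h | h <;> simp [h]
  rw [norm_mul, Complex.norm_I, mul_one, Complex.norm_real, Real.norm_eq_abs, abs_mul, hσabs,
    mul_one, abs_of_nonneg (by positivity)]

/-- The lattice constant `K₀ = 2πiσk` (`σ = ±1`) satisfies `e^{K₀} = 1`. [folklore] -/
theorem latticeConst_exp {σ : ℝ} (hσ : σ = 1 ∨ σ = -1) (k : ℕ) :
    exp (((2 * Real.pi * k * σ : ℝ) : ℂ) * I) = 1 := by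
  rcases hσ with h | h
  · rw [h, show (((2 * Real.pi * k * (1 : ℝ) : ℝ) : ℂ) * I) = (k : ℂ) * (2 * Real.pi * I) by
      push_cast; ring]
    exact Complex.exp_nat_mul_two_pi_mul_I k
  · rw [h, show (((2 * Real.pi * k * (-1 : ℝ) : ℝ) : ℂ) * I) = -((k : ℂ) * (2 * Real.pi * I))
      by push_cast; ring, Complex.exp_neg, Complex.exp_nat_mul_two_pi_mul_I, inv_one]

/-- **The escaping coordinate through its logarithm.** For `r > 0`, real `θ₀` and `η ∈ ℂ`, with
`Λ = log r + iθ₀ + η/D` one has `e^{Λ} = r e^{iθ₀} e^{η/D}` and `‖Λ‖ ≤ |log r| + |θ₀| + ‖η‖`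
(for `D ≥ 1`). [folklore] -/
theorem exp_logCoord (r θ₀ : ℝ) (η : ℂ) (D : ℕ) (hD : 0 < D) :
    exp ((Real.log r : ℂ) + θ₀ * I + η * (D : ℂ)⁻¹) =
        (Real.exp (Real.log r) : ℂ) * exp (θ₀ * I) * exp (η / D) ∧
      ‖(Real.log r : ℂ) + θ₀ * I + η * (D : ℂ)⁻¹‖ ≤ |Real.log r| + |θ₀| + ‖η‖ := by
  constructor
  · rw [Complex.exp_add, Complex.exp_add, Complex.ofReal_exp, div_eq_mul_inv]
  · have hD1 : (1 : ℝ) ≤ D := by exact_mod_cast hD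
    refine (norm_add_le _ _).trans (add_le_add ((norm_add_le _ _).trans (add_le_add ?_ ?_)) ?_)
    · rw [Complex.norm_real, Real.norm_eq_abs]
    · rw [norm_mul, Complex.norm_I, mul_one, Complex.norm_real, Real.norm_eq_abs]
    · rw [norm_mul, norm_inv, Complex.norm_natCast]
      calc ‖η‖ * (D : ℝ)⁻¹ ≤ ‖η‖ * 1 := by
            refine mul_le_mul_of_nonneg_left ?_ (norm_nonneg _)
            exact inv_le_one_of_one_le₀ hD1
        _ = ‖η‖ := mul_one _

end Summit.Schanuel.Schanuel.Theorems
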